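import Summits.QuantumFields.BalabanUV.Beta.D1BFx.SbpScalarEndMean
import Summits.QuantumFields.BalabanUV.Beta.D1BFx.RoadEndBFxRecutMeanShellS

/-!
# `BalabanUV.Beta.D1BFx.RoadEndBFxRecutMeanSbpS` — road «BF-x» for binder row D1: THE MEAN-GRADING «ENDₛ» END OVER THE TWO-PROFILE RE-CUT TABLE WITH NO
# SECOND-DIFFERENCE ROW — `RoadEndBFxRecutMeanShellS` (p293428) with the shell rows `h2s` ∕ `d2s` (and the idle constant `hD₂`) DELETED, over the OWNER d1-p2-g13's
# summation-by-parts scalar wall («C3-SBP», `SbpScalarEnd` PARTs 1–4) through the mean-lane root `SbpScalarEndMean.d1Drift_JsBalAn1Ctr_of_meanRoad_table_pinned_sbp`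

HONEST DEPENDENCY (page 1, mandatory): continuum YM on T⁴ ⇐ BetaPertH ∧ nine spine estimates (0/9 proved); BetaPertH ⇐ (D1) ∧ (D4) ∧
CAP+tail; G-an2-4 gates asym, D1 and NE2/3/4.  HONEST FRAMING (cell contract, verbatim): «discharging `BetaPertH` makes Bałaban's UV
stability UNCONDITIONAL — a real constructive-QFT result; it is NOT the continuum limit and NOT the Clay problem.»  THIS MODULE DISCHARGES
NOTHING of the wall: [folklore] composition BY NAME of `SbpScalarEndMean.d1Drift_JsBalAn1Ctr_of_meanRoad_table_pinned_sbp` with `AssemblyEndRecutS.defect_le_at_recutS`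
(mean target via `RoadEndBFxRecutMean.hT_mean_of_pointwise`), `RoadEndBFxRecutS.rest_all_of_offCornerS` and the near rows of `gfrz` (`D := rowConst a 0`, indices 0∕1 only
are read) — the body of `RoadEndBFxRecutMeanShellS.d1Drift_BFx_recut_mean_pinned_shellS` with the callee renamed and the two shell obligations gone.  No `def`, nothing
cited, 0 sorry.  0 wall binders; NOT (K), NOT D1, NOT `BetaPertH`, NOT continuum, NOT Clay.

ABSOLUTE RULE (cell charter, verbatim): «No internally-minted statement may enter as a cited fact. Every hypothesis is either kernel-proved in
this package or a verbatim quotation of a PUBLISHED theorem with page reference. The manuscript(s) under audit are NOT citable for their own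
disputed steps — they are the thing under adjudication; programme-internal (2001/route/tribunal) claims are never citable.»

WHY (owner d1-p2-g13 FINDING F-g13-1, journal l.35219 «C3-SBP»; OFFER → leaf-01 for the mean lane): the shell rows were superfluous for the wall; this is the per-word
mean END's twin with no leg second-difference row (the four remaining rows h0∕h1 are theorems, d0∕d1 stay displayed here as in the record — the `_of_prop12` reading
of d0∕d1 belongs to the total-rest lane `RoadEndBFxTotalMeanSbpS` §2).

CONTENT.
* [folklore] **`d1Drift_BFx_recut_mean_pinned_sbpS`** = `RoadEndBFxRecutMeanShellS.d1Drift_BFx_recut_mean_pinned_shellS` minus `hD₂ h2s d2s`.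
Unit `b2b-balaban-beta-d1-formalise-leaf-01` (gen 18), D1 formalisation swarm leaf prover 01, road «BF-x» MEAN lane; `LEAVES-BFx.md` rows «C3-SBP» (twins) and A7-ENDₛ (mean lane).
-/

noncomputable section

open Finset Filter Topology
open Literature.Probability.LatticeModels (annulus)
open scoped BigOperators
open Literature.MathematicalPhysics.QuantumFieldTheory.Balaban1983to89
open Literature.MathematicalPhysics.QuantumFieldTheory.Balaban1983to89.Beta
open OneStepResolventKernel (JetData)
open OneStepKernelFamily (TbalOf D1Drift)
open WindowIdentification (fullSum)
open DyadicShell (Pt supNorm)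
open ExpKernelCalculus (Site BiLoc shiftK)
open SquareTable (stK)
open GhostTable (gFree)
open BubbleTransfer (unitVec)
open DressedMomentNormalisation (resSite)
open Summit.QuantumFields.BalabanUV.Beta.TameKernelCalculus (Spr)
open Summit.QuantumFields.BalabanUV.Beta.MixedJetTablesPlug (JsBalAn1Ctr)
open Summit.QuantumFields.BalabanUV.Beta.GAN24.StencilSlotOfE3 (one_le_of_two_le)
open Summit.QuantumFields.BalabanUV.Beta.D1BFx.GluonLeg (Ga)
open Summit.QuantumFields.BalabanUV.Beta.D1BFx.ReducedKernel (TableR TOfRed)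
open Summit.QuantumFields.BalabanUV.Beta.D1BFx.DressedTadpoleTable (tableRed)
open Summit.QuantumFields.BalabanUV.Beta.D1BFx.ReducedKernelSandwich (fineHess)
open Summit.QuantumFields.BalabanUV.Beta.D1BFx.FineStencilBFBalaban (SbfBal)
open Summit.QuantumFields.BalabanUV.Beta.D1BFx.SecondStencilBF (Wbf)
open Summit.QuantumFields.BalabanUV.Beta.D1BFx.GhostKernelComplete (PghQ fineHessGhQ)
open Summit.QuantumFields.BalabanUV.Beta.D1BFx.FrozenLegProfile (gfrz gfrz_neg decay_gfrz abs_gfrz_sub_gFree_le abs_gfrz_diff_flat_le)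
open Summit.QuantumFields.BalabanUV.Beta.D1BFx.SplitInstance (RestIdx)
open Summit.QuantumFields.BalabanUV.Beta.D1BFx.SplitInstanceS (restKS)
open Summit.QuantumFields.BalabanUV.Beta.D1BFx.Assembly (sum_uniform_resSite)
open Summit.QuantumFields.BalabanUV.Beta.D1BFx.AssemblyEndRecutS (defect_le_at_recutS)
open Summit.QuantumFields.BalabanUV.Beta.D1BFx.RoadEndBFxRecut (cornerIdx rowConst gfrz₀ gfrz₀_eq rowConst_nonneg)
open Summit.QuantumFields.BalabanUV.Beta.D1BFx.RoadEndBFxRecutS (rest_all_of_offCornerS)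
open Summit.QuantumFields.BalabanUV.Beta.D1BFx.SbpScalarEndMean (d1Drift_JsBalAn1Ctr_of_meanRoad_table_pinned_sbp)
open Summit.QuantumFields.BalabanUV.Beta.D1BFx.RoadEndBFxRecutMean (hT_mean_of_pointwise)
namespace Summit.QuantumFields.BalabanUV.Beta.D1BFx.RoadEndBFxRecutMeanSbpS

variable {Lc : ℕ} [NeZero Lc] {a N : ℝ} {μ ν : Fin 4} {υ : Type*} [Fintype υ]
  {cE cVH cΛ cR cK cQ cE₂ cJ4 cΛ₂ cR₂ cQ₂ x₀ ωgl ωgh : ℕ → ℝ} {WE WJ WΛ WR WQ : ℕ → TableR} {CE CJ CΛ CRt CQ δW : ℕ → ℝ}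
  {Ru : υ → ℕ → ℝ} {CU : υ → ℝ} {CR : RestIdx → ℝ} {A : ℕ → ℝ} {δ : ℝ}

/-- [folklore] **ROAD BF-x, MEAN-GRADING END OVER THE TWO-PROFILE RE-CUT TABLE, variant «ENDₛ», NO SECOND-DIFFERENCE ROW** —
`RoadEndBFxRecutMeanShellS.d1Drift_BFx_recut_mean_pinned_shellS` with the binders `hD₂`, `h2s`, `d2s` DELETED and nothing else changed (B1 mean form for the road's own literal
at the pin `cE₂ = Lc⁸`, (K) + the rescaled tie `hωs`, `Spr (Ga n a)`, sockets, `hdiv`, `hrowgh`, d0∕d1 pointwise, (REST′) off-corner words `restKS (gfrz n a b) (s n • gfrz n a b)`, (U));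
the scalar wall is the OWNER's summation-by-parts wall in the mean grading (`SbpScalarEndMean.d1Drift_JsBalAn1Ctr_of_meanRoad_table_pinned_sbp`). -/
theorem d1Drift_BFx_recut_mean_pinned_sbpS (hL : 2 ≤ Lc) (hodd : Odd Lc) (cE' cVH' cΛ' cB' : ℝ) (Tc : Fin 4 → Fin 4 → Fin 4 → Fin 4 → ℝ)
    (hμν : μ ≠ ν) (hN : N ≠ 0) (ha : 0 < a) (c : ℕ → ℝ)
    (hA : ∀ j, 0 ≤ A j) (hδ : 0 < δ)
    -- the frozen profile's far rows d0∕d1 (pointwise, first order); NO second-difference row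
    (d0 : ∀ n : ℕ, 2 ≤ n → ∀ [NeZero n], ∀ b ∈ (univ : Finset (Fin 4 → Fin n)).image resSite, ∀ v : Pt, v ≠ 0 →
      |gfrz n a b v| ≤ A 0 * Real.exp (-(δ / n) * supNorm v) / (supNorm v : ℝ) ^ 2)
    (d1 : ∀ n : ℕ, 2 ≤ n → ∀ [NeZero n], ∀ b ∈ (univ : Finset (Fin 4 → Fin n)).image resSite, ∀ v : Pt, v ≠ 0 → ∀ ρ : Fin 4,
      |gfrz n a b (v + unitVec ρ) - gfrz n a b v| ≤ A 1 * Real.exp (-(δ / n) * supNorm v) / (supNorm v : ℝ) ^ 3)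
    -- bridge B1 in MEAN form, for the road's own literal at the pin `cE₂ = Lc⁸`
    (hB1 : Tendsto (fun m : ℕ => ((∑ j ∈ range m,
        B12Beta.secondMoment (TbalOf Lc (JsBalAn1Ctr (one_le_of_two_le hL) cE' cVH' cΛ' ((Lc : ℝ) ^ (2 * (3 + 1))) cB' Tc) j) μ ν) - c (Lc ^ m)) / (m : ℝ))
        atTop (𝓝 0))
    -- the (α)-leaf and slot (K) with the loop-weight ratio and the PINNED normalisation
    (hGa : ∀ n : ℕ, 2 ≤ n → ∀ [NeZero n], Spr (Ga n a))
    (hK : ∀ n : ℕ, 2 ≤ n → Odd n → ∀ [NeZero n], c n =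
      ωgl n * B12Beta.secondMoment (TOfRed n a (SbfBal n a (cE n) (cVH n) (cΛ n) (cR n) (cK n) (cQ n))
        (tableRed n (Wbf (cE₂ n) (cJ4 n) (cΛ₂ n) (cR₂ n) (cQ₂ n) (WE n) (WJ n) (WΛ n) (WR n) (WQ n)))) μ ν
      + ωgh n * B12Beta.secondMoment (PghQ n a (x₀ n) (cK n) (cQ n)) μ ν + ∑ u, Ru u n)
    (s : ℕ → ℝ) (hωs : ∀ n : ℕ, 2 ≤ n → ωgh n * (s n * cK n) ^ 2 = -2 * (ωgl n * cE n ^ 2))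
    (hlam : ∀ n : ℕ, 2 ≤ n → ωgl n * cE n ^ 2 = 2 * N ^ 2 * (n : ℝ) ^ 8)
    -- slot-table sockets
    (hδW : ∀ n, 0 < δW n)
    (hE : ∀ n κ u l u', BiLoc (WE n κ u l u') u u' (CE n) (δW n)) (hJ : ∀ n κ u l u', BiLoc (WJ n κ u l u') u u' (CJ n) (δW n))
    (hΛ : ∀ n κ u l u', BiLoc (WΛ n κ u l u') u u' (CΛ n) (δW n)) (hR : ∀ n κ u l u', BiLoc (WR n κ u l u') u u' (CRt n) (δW n))
    (hQ : ∀ n κ u l u', BiLoc (WQ n κ u l u') u u' (CQ n) (δW n))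
    (hEc : ∀ (n : ℕ) (κ : Fin 4) (u : Site 4) (l : Fin 4) (u' t : Site 4),
      WE n κ (u + (n : ℤ) • t) l (u' + (n : ℤ) • t) = shiftK (-((n : ℤ) • t)) (WE n κ u l u'))
    (hJc : ∀ (n : ℕ) (κ : Fin 4) (u : Site 4) (l : Fin 4) (u' t : Site 4),
      WJ n κ (u + (n : ℤ) • t) l (u' + (n : ℤ) • t) = shiftK (-((n : ℤ) • t)) (WJ n κ u l u'))
    (hΛc : ∀ (n : ℕ) (κ : Fin 4) (u : Site 4) (l : Fin 4) (u' t : Site 4),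
      WΛ n κ (u + (n : ℤ) • t) l (u' + (n : ℤ) • t) = shiftK (-((n : ℤ) • t)) (WΛ n κ u l u'))
    (hRc : ∀ (n : ℕ) (κ : Fin 4) (u : Site 4) (l : Fin 4) (u' t : Site 4),
      WR n κ (u + (n : ℤ) • t) l (u' + (n : ℤ) • t) = shiftK (-((n : ℤ) • t)) (WR n κ u l u'))
    (hQc : ∀ (n : ℕ) (κ : Fin 4) (u : Site 4) (l : Fin 4) (u' t : Site 4),
      WQ n κ (u + (n : ℤ) • t) l (u' + (n : ℤ) • t) = shiftK (-((n : ℤ) • t)) (WQ n κ u l u'))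
    (hEs : ∀ n κ u l u', WE n κ u l u' = WE n l u' κ u) (hJs : ∀ n κ u l u', WJ n κ u l u' = WJ n l u' κ u)
    (hΛs : ∀ n κ u l u', WΛ n κ u l u' = WΛ n l u' κ u) (hRs : ∀ n κ u l u', WR n κ u l u' = WR n l u' κ u)
    (hQs : ∀ n κ u l u', WQ n κ u l u' = WQ n l u' κ u)
    -- first-bond divergence-freeness of the gluon fine Hessian kernel; the ghost Ward rows
    (hdiv : ∀ n : ℕ, 2 ≤ n → ∀ [NeZero n], ∀ (l' : Fin 4) (u' u : Site 4), ∑ κ' : Fin 4,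
      (fineHess n a (SbfBal n a (cE n) (cVH n) (cΛ n) (cR n) (cK n) (cQ n))
          (Wbf (cE₂ n) (cJ4 n) (cΛ₂ n) (cR₂ n) (cQ₂ n) (WE n) (WJ n) (WΛ n) (WR n) (WQ n)) κ' l' (u - Pi.single κ' 1) u'
        - fineHess n a (SbfBal n a (cE n) (cVH n) (cΛ n) (cR n) (cK n) (cQ n))
          (Wbf (cE₂ n) (cJ4 n) (cΛ₂ n) (cR₂ n) (cQ₂ n) (WE n) (WJ n) (WΛ n) (WR n) (WQ n)) κ' l' u u') = 0)
    (hrowgh : ∀ n : ℕ, 2 ≤ n → ∀ [NeZero n], ∀ (κ' l' : Fin 4) (b : Site 4), HasSum (fineHessGhQ n a (x₀ n) (cK n) (cQ n) κ' l' b) 0)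
    -- (REST′) for the re-cut words other than the corner, n-UNIFORM; (U)
    (hRest : ∀ n : ℕ, 2 ≤ n → ∀ [NeZero n], ∀ τ : RestIdx, τ ≠ cornerIdx →
      |∑ b ∈ (univ : Finset (Fin 4 → Fin n)).image resSite, ((n : ℝ) ^ 4)⁻¹ *
        fullSum (fun w : Pt => restKS n a (gfrz n a b) (fun v => s n * gfrz n a b v) (cE n) (cΛ n) (cR n) (cK n) (cQ n) (cE₂ n) (cJ4 n) (cΛ₂ n) (cR₂ n) (cQ₂ n) (x₀ n)
          (WE n) (WJ n) (WΛ n) (WR n) (WQ n) (ωgl n) (ωgh n) ((n : ℝ) ^ 8) N μ ν b τ w)| ≤ CR τ)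
    (hU : ∀ n : ℕ, 2 ≤ n → ∀ u, |Ru u n| ≤ CU u) :
    D1Drift Lc (JsBalAn1Ctr (one_le_of_two_le hL) cE' cVH' cΛ' ((Lc : ℝ) ^ (2 * (3 + 1))) cB' Tc) N μ ν := by
  refine d1Drift_JsBalAn1Ctr_of_meanRoad_table_pinned_sbp hL cE' cVH' cΛ' cB' Tc hμν hN c
    (Bset := fun n => (univ : Finset (Fin 4 → Fin n)).image resSite) (wt := fun n _ => ((n : ℝ) ^ 4)⁻¹) (Gf := gfrz₀ a)
    (D := rowConst a 0) (A := A) (δ := δ)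
    (rowConst_nonneg ha le_rfl) hA hδ (fun n _ _ _ => by positivity) (fun n hn => sum_uniform_resSite (by omega)) ?_ ?_ ?_ ?_ hB1 ?_
  · intro n hn b _ v
    haveI : NeZero n := ⟨by omega⟩
    rw [gfrz₀_eq a n]
    exact abs_gfrz_sub_gFree_le n (le_trans one_le_two hn) ha b v
  · intro n hn b _ v ρ
    haveI : NeZero n := ⟨by omega⟩
    rw [gfrz₀_eq a n]
    exact abs_gfrz_diff_flat_le n (le_trans one_le_two hn) ha b v ρ
  · intro n hn b hb v hv
    haveI : NeZero n := ⟨by omega⟩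
    rw [gfrz₀_eq a n]
    exact d0 n hn b hb v hv
  · intro n hn b hb v hv ρ
    haveI : NeZero n := ⟨by omega⟩
    rw [gfrz₀_eq a n]
    exact d1 n hn b hb v hv ρ
  -- the mean target from the pointwise defect bound
  refine hT_mean_of_pointwise (c := c)
    (F := fun n => ∑ b ∈ (univ : Finset (Fin 4 → Fin n)).image resSite, ((n : ℝ) ^ 4)⁻¹ * fullSum (stK μ ν N (gfrz₀ a n b)))
    (U := (∑ u, CU u) + ∑ τ : RestIdx, (if τ = cornerIdx then 0 else CR τ)) (fun n hn hon => ?_) hL hodd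
  haveI : NeZero n := ⟨by omega⟩
  rw [gfrz₀_eq a n]
  exact defect_le_at_recutS n a (cE n) (cVH n) (cΛ n) (cR n) (cK n) (cQ n) (cE₂ n) (cJ4 n) (cΛ₂ n) (cR₂ n) (cQ₂ n) (x₀ n) (ωgl n) (ωgh n)
    ((n : ℝ) ^ 8) N (gp := gfrz n a) hn hon ha hμν (hGa n hn) (hK n hn hon) (s n) (hωs n hn) (hlam n hn) (hδW n) (hE n) (hJ n) (hΛ n) (hR n)
    (hQ n) (hEc n) (hJc n) (hΛc n) (hRc n) (hQc n) (hEs n) (hJs n) (hΛs n) (hRs n) (hQs n) (hdiv n hn) (hrowgh n hn)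
    (fun b => decay_gfrz (hGa n hn) b) (fun b w => gfrz_neg w)
    (rest_all_of_offCornerS n a (cE n) (cΛ n) (cR n) (cK n) (cQ n) (cE₂ n) (cJ4 n) (cΛ₂ n) (cR₂ n) (cQ₂ n) (x₀ n) (ωgl n) (ωgh n) N
      (WE n) (WJ n) (WΛ n) (WR n) (WQ n) hμν (hGa n hn) (fun b v => s n * gfrz n a b v) (hRest n hn)) (hU n hn)

end Summit.QuantumFields.BalabanUV.Beta.D1BFx.RoadEndBFxRecutMeanSbpS

end
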